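/-
Copyright (c) 2026. All rights reserved.
Released under Apache 2.0 license as described in the file LICENSE.
Authors: abc-iut cell — seat abc-iut-w6-d024 (gen 4; block C / W6; continuation of L4-lead RULING #8h row
«COR27e-ORBI-TRANSPORT» — the residual «(e) at a genuine 𝔼: transport of Aut^hol along the holomorphic
coordinate κ»).  PROOF-ONLY — no definitions.
-/
import Literature.AnabelianGeometry.AbsoluteAnabelian.HolomorphicEllipticCuspidalizationLocalAddChartProofs
import Literature.AnabelianGeometry.AbsoluteAnabelian.HolomorphicEllipticCuspidalizationGenuineGroupLaw
import Literature.AnabelianGeometry.AbsoluteAnabelian.ArchimedeanReconstructionCor29Cor27eJunction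
import Literature.AnabelianGeometry.AbsoluteAnabelian.ArchimedeanHolFieldFunctorGeometric
import HarnessLib

/-!
# [AbsTopIII] Cor 2.7 (d)/(e) at a GENUINE punctured elliptic curve: a chart disc `U ∋ p` of `E` whose
# Aut-holomorphic structure is that of a planar disc, through the coordinate `κ` that linearises (c)

S. Mochizuki, *Topics in absolute anabelian geometry III* (bib key `MochizukiAbsTopIII2015`), Cor 2.7 (d)
(kurims p.59 l.27–28: "Let `𝕍` be the Aut-holomorphic space determined by a parallelogram `V^top ⊆ E^top`")
and (e) (p.60 l.2–14).  PROOF-ONLY file (no definitions).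

For a punctured elliptic curve `E` carrying the group law of (c) (abc-iut-L4-t8 p437372 / abc-iut-w6-d031
p439414: `∞ = 0`, `ψ : OnePoint E ≃ₜ+ ℂ/Φ(ℤ²)` holomorphic on `E`) and `p ∈ E`, the coordinate
`κ := chartAt (ψ p) ∘ ψ` of `HolomorphicEllipticCuspidalizationLocalAddChartProofs.lean` (abc-iut-w6-d024,
p443220 — it LINEARISES the local additive structure of (c)) restricts to a homeomorphism

  `ε : U ≃ₜ B(κ p, r)`   of an open `U ∋ p` of `E` onto a planar ball,

holomorphic with holomorphic inverse (`Cor27c.exists_chartDisc`); hence (Def 2.1 (ii), abc-iut-L4-t14's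
`HolRS.holAut_map_homeoConj_of_mdifferentiable`) conjugation by `ε` carries `Aut^hol(U) = 𝒜_𝔼(U^top)` ONTO
`Aut^hol(B)`: the Aut-holomorphic space `𝕌` determined by `U^top ⊆ E^top` IS a planar Aut-holomorphic disc
(`isAutHolDisc_ball`), its one-parameter subgroups and order-four stabilisers are those of `Aut^hol(B)`, and
abc-iut-w6-d024's germ-model theorems apply AT `κ p`: the frames of (d) read off `Aut^hol(B)` are
`{(0,0)} ∪ {non-zero orthogonal pairs}` and cut out `𝒜_{κ p} = germAut (κ p)` (`Cor27c.genuine_summary`: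
`germAutFromAutHol B ⟨κ p, _⟩ = germAut (κ p)` together with the transport and the planarity of (c) in the
SAME coordinate `κ`).

So at a genuine `𝔼`, «(e) read in the holomorphic coordinate `κ`» is exactly the statement discharged at
the germ model (p440390), with (c)'s additive structure identified (p443220) and `𝒜_𝕌 ≅ 𝒜_𝔹` (this
file).  HONEST SCOPE: `κ` is ONE coordinate (chart-independence of the resulting `𝒜_p` = "same multiplier",
p441307/p442863); the orbispace `X^top` itself stays campaign-L.  Refereed pre-IUT material; nothing here
bears on the disputed [IUTchIII] Cor. 3.12; typed ≠ endorsed.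
-/

noncomputable section

namespace Literature.AnabelianGeometry.AbsoluteAnabelian

namespace Cor27c

open _root_.TopologicalSpace _root_.Topology _root_.Set _root_.Metric _root_.Function _root_.Filter _root_.OnePoint
open scoped _root_.Manifold _root_.ContDiff
open Literature.Geometry.Kaehler (ComplexTorus)
open Literature.Geometry.Kaehler.ComplexTorus (chart chartAt_eq)
open HolomorphicEllipticCuspidalization

variable {E : Type} [TopologicalSpace E] [ChartedSpace ℂ E] [IsManifold 𝓘(ℂ, ℂ) ω E]
  [AddCommGroup (OnePoint E)] {ι : Type} [Fintype ι] {Φ : (ι → ℝ) ≃L[ℝ] ℂ}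

/-- **A chart disc of the genuine curve in the coordinate `κ = chartAt (ψ p) ∘ ψ`**: an open `U ∋ p` of
`E` and a homeomorphism `ε : U ≃ₜ B(κ p, r)` onto a planar ball given by `κ`, holomorphic with holomorphic
inverse, so that conjugation by `ε` carries `Aut^hol(U)` onto `Aut^hol(B(κ p, r))` ("the Aut-holomorphic
space determined by [a small disc] `U^top ⊆ E^top`" is a planar Aut-holomorphic disc, Def 2.1 (ii)).
[cite: MochizukiAbsTopIII2015, Corollary 2.7 (d) p.59] -/
theorem exists_chartDisc (hinf : (∞ : OnePoint E) = 0) (ψ : OnePoint E ≃ₜ+ ComplexTorus Φ)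
    (hψ : MDifferentiable 𝓘(ℂ, ℂ) 𝓘(ℂ, ℂ) (fun x : E => ψ x)) (p : E) :
    ∃ (U : Opens E) (_ : p ∈ U) (r : ℝ) (_ : 0 < r)
      (ε : U ≃ₜ ↥(⟨ball (chartAt ℂ (ψ (p : OnePoint E)) (ψ p)) r, isOpen_ball⟩ : Opens ℂ)),
      (∀ x : U, ((ε x : ↥(⟨ball (chartAt ℂ (ψ (p : OnePoint E)) (ψ p)) r, isOpen_ball⟩ : Opens ℂ)) : ℂ) =
          chartAt ℂ (ψ (p : OnePoint E)) (ψ (x : E))) ∧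
      MDifferentiable 𝓘(ℂ, ℂ) 𝓘(ℂ, ℂ) ε ∧ MDifferentiable 𝓘(ℂ, ℂ) 𝓘(ℂ, ℂ) ε.symm ∧
      (holAut U).map (homeoConj ε).toMonoidHom =
        holAut (⟨ball (chartAt ℂ (ψ (p : OnePoint E)) (ψ p)) r, isOpen_ball⟩ : Opens ℂ) := by
  obtain ⟨e, he⟩ := exists_homeomorph_coe_eq hinf ψ
  have hme : MDifferentiable 𝓘(ℂ, ℂ) 𝓘(ℂ, ℂ) e := mdifferentiable_of_coe_comp he hψ
  -- `ψ` of a point of `E`, recovered through `e`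
  have hψe : ∀ y : ↥(puncturedTorus Φ), ψ ((e.symm y : E) : OnePoint E) = (y : ComplexTorus Φ) := by
    intro y; rw [← he, e.apply_symm_apply]
  set ch := chartAt ℂ (ψ (p : OnePoint E)) with hch
  set z₀ : ℂ := ch (ψ (p : OnePoint E)) with hz₀
  have hsrc : ψ (p : OnePoint E) ∈ ch.source := mem_chart_source ℂ _
  have hψp : ψ (p : OnePoint E) ≠ 0 := by
    have h := (mem_range_coe_iff_map_ne_zero hinf ψ (p : OnePoint E)).1 (mem_range_self p)
    exact (mem_puncturedTorus_iff Φ _).1 h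
  -- the window: chart target, away from the image of the origin
  have hW : IsOpen (ch.target ∩ ch.symm ⁻¹' ({0}ᶜ : Set (ComplexTorus Φ))) :=
    ch.continuousOn_symm.isOpen_inter_preimage ch.open_target isOpen_compl_singleton
  have hz₀W : z₀ ∈ ch.target ∩ ch.symm ⁻¹' ({0}ᶜ : Set (ComplexTorus Φ)) := by
    refine ⟨ch.map_source hsrc, ?_⟩
    rw [mem_preimage, hz₀, ch.left_inv hsrc]
    exact hψp
  obtain ⟨r, hr, hball⟩ := Metric.isOpen_iff.1 hW z₀ hz₀W
  -- the disc `U ∋ p` of `E`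
  have hs : IsOpen ((fun x : E => ψ x) ⁻¹' ch.source) :=
    ch.open_source.preimage (ψ.continuous.comp continuous_coe)
  have hUo : IsOpen ((fun x : E => ψ x) ⁻¹' ch.source ∩ (fun x : E => ch (ψ x)) ⁻¹' ball z₀ r) := by
    refine ContinuousOn.isOpen_inter_preimage ?_ hs isOpen_ball
    exact ch.continuousOn.comp (ψ.continuous.comp continuous_coe).continuousOn fun x hx => hx
  let U : Opens E := ⟨(fun x : E => ψ x) ⁻¹' ch.source ∩ (fun x : E => ch (ψ x)) ⁻¹' ball z₀ r, hUo⟩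
  have hpU : p ∈ U := ⟨hsrc, mem_ball_self hr⟩
  let B : Opens ℂ := ⟨ball z₀ r, isOpen_ball⟩
  -- membership facts for the inverse
  have hinvT : ∀ z : B, (z : ℂ) ∈ ch.target := fun z => (hball z.2).1
  have hinv0 : ∀ z : B, ch.symm (z : ℂ) ∈ puncturedTorus Φ := fun z =>
    (mem_puncturedTorus_iff Φ _).2 (hball z.2).2
  have hinvU : ∀ z : B, (e.symm ⟨ch.symm (z : ℂ), hinv0 z⟩ : E) ∈ U := by
    intro z
    refine ⟨?_, ?_⟩
    · show ψ ((e.symm ⟨ch.symm (z : ℂ), hinv0 z⟩ : E) : OnePoint E) ∈ ch.source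
      rw [hψe]; exact ch.map_target (hinvT z)
    · show ch (ψ ((e.symm ⟨ch.symm (z : ℂ), hinv0 z⟩ : E) : OnePoint E)) ∈ ball z₀ r
      rw [hψe]
      show ch (ch.symm (z : ℂ)) ∈ ball z₀ r
      rw [ch.right_inv (hinvT z)]; exact z.2
  -- the homeomorphism
  let ε : U ≃ₜ B :=
    { toFun := fun x => ⟨ch (ψ ((x : E) : OnePoint E)), x.2.2⟩
      invFun := fun z => ⟨e.symm ⟨ch.symm (z : ℂ), hinv0 z⟩, hinvU z⟩
      left_inv := fun x => by
        apply Subtype.ext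
        show (e.symm ⟨ch.symm (ch (ψ ((x : E) : OnePoint E))), _⟩ : E) = x
        have h1 : ch.symm (ch (ψ ((x : E) : OnePoint E))) = ψ ((x : E) : OnePoint E) := ch.left_inv x.2.1
        have h2 : (⟨ch.symm (ch (ψ ((x : E) : OnePoint E))), hinv0 ⟨_, x.2.2⟩⟩ : ↥(puncturedTorus Φ)) =
            e (x : E) := Subtype.ext (by rw [he]; exact h1)
        rw [h2, e.symm_apply_apply]
      right_inv := fun z => by
        apply Subtype.ext
        show ch (ψ ((e.symm ⟨ch.symm (z : ℂ), hinv0 z⟩ : E) : OnePoint E)) = z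
        rw [hψe]
        exact ch.right_inv (hinvT z)
      continuous_toFun := by
        refine Continuous.subtype_mk ?_ _
        exact ch.continuousOn.comp_continuous
          ((ψ.continuous.comp continuous_coe).comp continuous_subtype_val) fun x => x.2.1
      continuous_invFun := by
        refine Continuous.subtype_mk (e.symm.continuous.comp (Continuous.subtype_mk ?_ _)) _
        exact ch.continuousOn_symm.comp_continuous continuous_subtype_val hinvT }
  have hεval : ∀ x : U, ((ε x : B) : ℂ) = ch (ψ ((x : E) : OnePoint E)) := fun x => rfl
  -- holomorphy of `ε` : it is the coordinate `κ = chart ∘ ψ` read on `U`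
  have hε : MDifferentiable 𝓘(ℂ, ℂ) 𝓘(ℂ, ℂ) ε := by
    intro x
    refine (mdifferentiableAt_opens_iff (U := U) (V := B) (Φ := fun y : E => ch (ψ (y : OnePoint E)))
      (Ψ := ε) (fun y => rfl) x).2 ?_
    exact mdifferentiableAt_chart_comp hψ (Literature.Geometry.Kaehler.ComplexTorus.corner Φ (ψ (p : OnePoint E))) x.2.1
  -- holomorphy of `ε⁻¹` : a bijective holomorphic map of the connected Riemann surface `U`
  haveI : ConnectedSpace B := Subtype.connectedSpace (isConnected_ball hr)
  have hε' : MDifferentiable 𝓘(ℂ, ℂ) 𝓘(ℂ, ℂ) ε.symm := by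
    haveI : ConnectedSpace U := ε.symm.surjective.connectedSpace ε.symm.continuous
    exact Literature.Geometry.Kaehler.RiemannSurface.mdifferentiable_symm_of_bijective hε ε.bijective ε rfl
  exact ⟨U, hpU, r, hr, ε, hεval, hε, hε', HolRS.holAut_map_homeoConj_of_mdifferentiable ε hε hε'⟩

/-- **[AbsTopIII] Cor 2.7 (d)/(e) at the genuine `𝔼`, assembled in ONE holomorphic coordinate.**  For a
punctured elliptic curve `E` with the group law of (c) and `p ∈ E`, with `κ := chartAt (ψ p) ∘ ψ`: there is a
chart disc `U ∋ p` with `ε : U ≃ₜ B := B(κ p, r)` given by `κ`, such that (i) conjugation by `ε` carries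
`Aut^hol(U) = 𝒜_𝔼(U^top)` onto `Aut^hol(B)` (so the one-parameter subgroups / order-four stabilisers of
Cor 2.7 (d) for `𝕌` are those of the planar disc `B`); (ii) `B` is a planar Aut-holomorphic disc; (iii) the
group cut out at `κ p` by the frames of (d) read off `Aut^hol(B)` alone is `𝒜_{κ p} = germAut (κ p)`
(abc-iut-w6-d024 `cor27eGermAutFromAutHol_holds`); (iv) the local additive structure of (c) is PLANAR in the
same coordinate `κ` (abc-iut-w6-d024 `Cor27c.eventually_localAdd_chartAt`).  I.e. «(e) read in `κ`» at the
genuine object is the germ-model statement. [cite: MochizukiAbsTopIII2015, Corollary 2.7 (e) p.60] -/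
theorem genuine_summary (hinf : (∞ : OnePoint E) = 0) (ψ : OnePoint E ≃ₜ+ ComplexTorus Φ)
    (hψ : MDifferentiable 𝓘(ℂ, ℂ) 𝓘(ℂ, ℂ) (fun x : E => ψ x)) (p : E) :
    ∃ (U : Opens E) (_ : p ∈ U) (r : ℝ) (hr : 0 < r)
      (ε : U ≃ₜ ↥(⟨ball (chartAt ℂ (ψ (p : OnePoint E)) (ψ p)) r, isOpen_ball⟩ : Opens ℂ)),
      (∀ x : U, ((ε x : ↥(⟨ball (chartAt ℂ (ψ (p : OnePoint E)) (ψ p)) r, isOpen_ball⟩ : Opens ℂ)) : ℂ) =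
          chartAt ℂ (ψ (p : OnePoint E)) (ψ (x : E))) ∧
      (holAut U).map (homeoConj ε).toMonoidHom =
        holAut (⟨ball (chartAt ℂ (ψ (p : OnePoint E)) (ψ p)) r, isOpen_ball⟩ : Opens ℂ) ∧
      IsAutHolDisc (⟨ball (chartAt ℂ (ψ (p : OnePoint E)) (ψ p)) r, isOpen_ball⟩ : Opens ℂ) ∧
      germAutFromAutHol (⟨ball (chartAt ℂ (ψ (p : OnePoint E)) (ψ p)) r, isOpen_ball⟩ : Opens ℂ)
          ⟨chartAt ℂ (ψ (p : OnePoint E)) (ψ p), mem_ball_self hr⟩ =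
        (germAut (chartAt ℂ (ψ (p : OnePoint E)) (ψ p)) :
          Set (LocGerm (chartAt ℂ (ψ (p : OnePoint E)) (ψ p)))ˣ) ∧
      ∀ᶠ ab : E × E in 𝓝 (p, p),
        chartAt ℂ (ψ (p : OnePoint E)) (ψ ((ab.1 : OnePoint E) + ab.2 - p)) =
          chartAt ℂ (ψ (p : OnePoint E)) (ψ ab.1) + chartAt ℂ (ψ (p : OnePoint E)) (ψ ab.2) -
            chartAt ℂ (ψ (p : OnePoint E)) (ψ p) := by
  obtain ⟨U, hpU, r, hr, ε, hεval, -, -, hmap⟩ := exists_chartDisc hinf ψ hψ p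
  have hdisc : IsAutHolDisc (⟨ball (chartAt ℂ (ψ (p : OnePoint E)) (ψ p)) r, isOpen_ball⟩ : Opens ℂ) :=
    isAutHolDisc_ball _ hr
  exact ⟨U, hpU, r, hr, ε, hεval, hmap, hdisc, cor27eGermAutFromAutHol_holds _ hdisc _,
    eventually_localAdd_chartAt ψ p⟩

end Cor27c

end Literature.AnabelianGeometry.AbsoluteAnabelian

end
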